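import Summits.Ventures.PercRepro.GenQTypeOne

/-!
# PercRepro — C-025 at `(q + 2, q)`: the type-`2` balance at every `q` by the counting of §21.3 (night-4, gen 0)

mine-2's Theorem 21.3 (`t = 2`, the landed `J_two_nonneg_of_nine_le` at `q = 4`) in general, with a crude constant:
at type `2` a rank-`q` set `B ⊆ G` receives `q·w_∞(B)` and only the independent `q`-sets are in deficit (`q/(q + 1)`
against `Φ = (q + 2)/(q + 1)`: deficit `2/(q + 1)` each); a rank-`q` set `C` with `q + 1` points has
`i_q(C) = q + 1 − m(C)` independent `q`-subsets and surplus `σ(C) = q/(1 + m(C)) − Φ ≥ κ · i_q(C)` with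
`κ = 2/(3(q − 1)(q + 1))` (`sigma_ge_kappa_mul`: the quadratic `(q − 1 − u)(3q(q + 1) − 2u) ≥ 0`, `u = 1 + m(C)`);
larger sets have `σ ≥ 0`; and the double count `Σ_{C} i_q(C) = I_q · (g − q)` (here as the two inequalities
`card_sdiff_le_card_supersets` / `card_subsets_add_mTr_le` with `Finset.sum_comm`).  Hence

* **`Jq_two_nonneg`** — THE TYPE-`2` BALANCE AT EVERY `q`: for a simple matroid and a rank-`q` set `G` with `g` points,
  `q ≥ 2` and `g ≥ 4q − 3`, `0 ≤ Jq M G q 2`.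

At `q = 4` the threshold is `g ≥ 13` (21.3 gets `g ≥ 9` from the finer `lpp` analysis of the `(q + 2)`-point sets, and
`g ≤ 8` from the demand bonus with catalogue numbers); the sizes below the threshold stay in the residue.
-/

namespace PercRepro.GenQ

open Finset ThmH SixFour

variable {α : Type*} [DecidableEq α] {M : Matroid α} [M.Finite]

/-! ## The two injections of the double count -/

/-- Every independent `q`-subset `B` of `G` lies in at least `g − q` rank-`q` sets with `q + 1` points
(`y ↦ B ∪ {y}`). -/
theorem card_sdiff_le_card_supersets {G B : Finset α} {q : ℕ} (hr : M.eRk (G : Set α) = (q : ℕ∞))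
    (hB : B ∈ Iq M G q) : (G \ B).card ≤ ((Nq1 M G q).filter (fun C => B ⊆ C)).card := by
  rw [Iq, Finset.mem_filter, mem_Rq] at hB
  apply Finset.card_le_card_of_injOn (fun y => insert y B)
  · intro y hy
    rw [Finset.mem_coe, Finset.mem_sdiff] at hy
    rw [Finset.mem_coe, Finset.mem_filter, Nq1, Finset.mem_filter, mem_Rq]
    have hsub : insert y B ⊆ G := Finset.insert_subset hy.1 hB.1.1
    refine ⟨⟨⟨hsub, ?_⟩, ?_⟩, Finset.subset_insert y B⟩
    · apply le_antisymm
      · rw [← hr]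
        exact M.eRk_mono (Finset.coe_subset.2 hsub)
      · rw [← hB.1.2]
        exact M.eRk_mono (Finset.coe_subset.2 (Finset.subset_insert _ _))
    · rw [Finset.card_insert_of_notMem hy.2, hB.2]
  · intro y hy y' hy' hyy'
    rw [Finset.mem_coe, Finset.mem_sdiff] at hy hy'
    simp only at hyy'
    have : y ∈ insert y' B := by
      rw [← hyy']
      exact Finset.mem_insert_self y B
    rcases Finset.mem_insert.1 this with h | h
    · exact h
    · exact absurd h hy.2

/-- A rank-`q` set `C` with `q + 1` points contains at most `q + 1 − m(C)` independent `q`-subsets: `B ↦ C ∖ B`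
injects them into the singletons of the non-coloops of `M|C`. -/
theorem card_subsets_add_mTr_le {G C : Finset α} {q : ℕ} (hG : G ⊆ gr M) (hC : C ∈ Nq1 M G q) :
    ((Iq M G q).filter (fun B => B ⊆ C)).card + mTr M C ≤ q + 1 := by
  rw [Nq1, Finset.mem_filter, mem_Rq] at hC
  have hCg : C ⊆ gr M := hC.1.1.trans hG
  have hsplit := Finset.card_sdiff_add_card_eq_card (coloopsOf_subset (M := M) C)
  have hle : ((Iq M G q).filter (fun B => B ⊆ C)).card ≤ (C \ coloopsOf M C).card := by
    refine le_trans (Finset.card_le_card_of_injOn (fun B => C \ B) ?_ ?_)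
      (Finset.card_image_le (f := fun y => ({y} : Finset α)))
    · intro B hB
      rw [Finset.mem_coe, Finset.mem_filter, Iq, Finset.mem_filter, mem_Rq] at hB
      obtain ⟨⟨⟨-, hrB⟩, hcard⟩, hBC⟩ := hB
      have h1 : (C \ B).card = 1 := by
        rw [Finset.card_sdiff_of_subset hBC, hC.2, hcard]
        omega
      obtain ⟨y, hy⟩ := Finset.card_eq_one.1 h1
      rw [Finset.mem_coe, Finset.mem_image]
      refine ⟨y, ?_, hy.symm⟩
      have hyC : y ∈ C \ B := by
        rw [hy]
        exact Finset.mem_singleton_self y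
      rw [Finset.mem_sdiff] at hyC ⊢
      refine ⟨hyC.1, ?_⟩
      -- `y` is not a coloop of `M|C`: `C ∖ {y} = B` has rank `q = ρ(C)`
      rw [mem_coloopsOf]
      rintro ⟨-, hycl⟩
      have hBeq : C.erase y = B := by
        rw [← Finset.sdiff_singleton_eq_erase, ← hy, Finset.sdiff_sdiff_eq_self hBC]
      have hyE : y ∈ M.E := by
        rw [← coe_gr M]
        exact_mod_cast hCg hyC.1
      have h2 := Matroid.eRk_insert_eq_add_one (M := M) (e := y) (X := ((C.erase y : Finset α) : Set α))
        ⟨hyE, hycl⟩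
      rw [← Finset.coe_insert, Finset.insert_erase hyC.1, hC.1.2, hBeq, hrB] at h2
      have h3 : ((q + 1 : ℕ) : ℕ∞) = (q : ℕ∞) := by
        push_cast
        exact h2.symm
      have h4 := (Nat.cast_inj (R := ℕ∞)).1 h3
      omega
    · intro B hB B' hB' hBB'
      rw [Finset.mem_coe, Finset.mem_filter] at hB hB'
      simp only at hBB'
      rw [← Finset.sdiff_sdiff_eq_self hB.2, ← Finset.sdiff_sdiff_eq_self hB'.2, hBB']
  unfold mTr
  omega

/-! ## The surplus of a `(q + 1)`-point set -/

/-- `σ(C) = q/(1 + c) − (q + 2)/(q + 1) ≥ (2/(3(q − 1)(q + 1))) · (q + 1 − c)` for `0 ≤ c ≤ q − 2`, `q ≥ 2`. -/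
theorem sigma_ge_kappa_mul {q c : ℕ} (hq : 2 ≤ q) (hc : c + 2 ≤ q) :
    (2 / (3 * ((q : ℚ) - 1) * ((q : ℚ) + 1))) * ((q : ℚ) + 1 - c) ≤
      (q : ℚ) / (1 + (c : ℚ)) - ((q : ℚ) + 2) / ((q : ℚ) + 1) := by
  have hq' : (2 : ℚ) ≤ q := by exact_mod_cast hq
  have hc' : (c : ℚ) + 2 ≤ q := by exact_mod_cast hc
  have hc0 : (0 : ℚ) ≤ c := by positivity
  have h1 : (0 : ℚ) < (q : ℚ) - 1 := by linarith
  have h2 : (0 : ℚ) < (q : ℚ) + 1 := by linarith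
  have h3 : (0 : ℚ) < 1 + (c : ℚ) := by linarith
  rw [← sub_nonneg]
  have e : (q : ℚ) / (1 + (c : ℚ)) - ((q : ℚ) + 2) / ((q : ℚ) + 1) -
      (2 / (3 * ((q : ℚ) - 1) * ((q : ℚ) + 1))) * ((q : ℚ) + 1 - c) =
      (((q : ℚ) - 1 - (1 + c)) * (3 * (q : ℚ) * ((q : ℚ) + 1) - 2 * (1 + c))) /
        (3 * ((q : ℚ) - 1) * ((q : ℚ) + 1) * (1 + (c : ℚ))) := by
    field_simp
    ring
  rw [e]
  apply div_nonneg
  · apply mul_nonneg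
    · linarith
    · nlinarith
  · positivity

/-! ## The type-`2` balance -/

/-- **The type-`2` balance at every `q`** (mine-2's 21.3 in general, crude constant): for a simple matroid and a
rank-`q` set `G` with `g` points, `q ≥ 2` and `g ≥ 4q − 3`, `0 ≤ Jq M G q 2`. -/
theorem Jq_two_nonneg (hs : Simple M) {G : Finset α} {q : ℕ} (hG : G ⊆ gr M)
    (hr : M.eRk (G : Set α) = (q : ℕ∞)) (hq : 2 ≤ q) (hg : 4 * q ≤ G.card + 3) : 0 ≤ Jq M G q 2 := by
  classical
  set Φ : ℚ := ((q : ℚ) + 2) / ((q : ℚ) + 1) with hΦ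
  set κ : ℚ := 2 / (3 * ((q : ℚ) - 1) * ((q : ℚ) + 1)) with hκ
  have hq' : (2 : ℚ) ≤ q := by exact_mod_cast hq
  have hq1 : (0 : ℚ) < (q : ℚ) - 1 := by linarith
  have hq2 : (0 : ℚ) < (q : ℚ) + 1 := by linarith
  have hκ0 : 0 ≤ κ := by rw [hκ]; positivity
  -- the three kinds of rank-`q` sets
  set I := Iq M G q with hI
  set N1 := Nq1 M G q with hN1
  set Rest := ((Rq M G q).filter (fun B : Finset α => ¬ B.card = q)).filter
    (fun B : Finset α => ¬ B.card = q + 1) with hRest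
  have hsplit : ∑ B ∈ Rq M G q, ((q : ℚ) * wInf M B - Φ) =
      ∑ B ∈ I, ((q : ℚ) * wInf M B - Φ) + (∑ B ∈ N1, ((q : ℚ) * wInf M B - Φ) +
        ∑ B ∈ Rest, ((q : ℚ) * wInf M B - Φ)) := by
    rw [hI, hN1, hRest, Iq, Nq1]
    rw [← Finset.sum_filter_add_sum_filter_not (Rq M G q) (fun B : Finset α => B.card = q)]
    congr 1
    rw [← Finset.sum_filter_add_sum_filter_not ((Rq M G q).filter (fun B : Finset α => ¬ B.card = q))
      (fun B : Finset α => B.card = q + 1)]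
    congr 1
    apply Finset.sum_congr _ (fun _ _ => rfl)
    ext B
    simp only [Finset.mem_filter, mem_Rq]
    constructor
    · rintro ⟨⟨h1, h2⟩, h3⟩
      exact ⟨h1, h3⟩
    · rintro ⟨h1, h3⟩
      exact ⟨⟨h1, by omega⟩, h3⟩
  -- (I) the independent `q`-sets: deficit `2/(q + 1)` each
  have hIsum : (I.card : ℚ) * (-(2 / ((q : ℚ) + 1))) ≤ ∑ B ∈ I, ((q : ℚ) * wInf M B - Φ) := by
    rw [← nsmul_eq_mul]
    apply Finset.card_nsmul_le_sum
    intro B hB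
    rw [hI, Iq, Finset.mem_filter, mem_Rq] at hB
    have hw := wInf_ge_of_eRk_eq (hB.1.1.trans hG) hB.1.2
    have hq0 : (0 : ℚ) ≤ q := by positivity
    have : (q : ℚ) * (1 / ((q : ℚ) + 1)) ≤ (q : ℚ) * wInf M B := mul_le_mul_of_nonneg_left hw hq0
    have e : (q : ℚ) * (1 / ((q : ℚ) + 1)) - Φ = -(2 / ((q : ℚ) + 1)) := by
      rw [hΦ]
      field_simp
      ring
    linarith
  -- (N1) the `(q + 1)`-point sets: surplus `≥ κ · i_q(C)`
  have hN1sum : ∑ C ∈ N1, κ * ((q : ℚ) + 1 - mTr M C) ≤ ∑ B ∈ N1, ((q : ℚ) * wInf M B - Φ) := by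
    apply Finset.sum_le_sum
    intro C hC
    rw [hN1, Nq1, Finset.mem_filter, mem_Rq] at hC
    have hm := mTr_add_two_le_of_simple hs (by omega) (hC.1.1.trans hG) hC.1.2 (by omega)
    have h := sigma_ge_kappa_mul hq hm
    unfold wInf
    rw [hΦ, hκ, mul_one_div]
    exact h
  -- (Rest) the larger sets: surplus `≥ 0`
  have hRestsum : 0 ≤ ∑ B ∈ Rest, ((q : ℚ) * wInf M B - Φ) := by
    apply Finset.sum_nonneg
    intro B hB
    rw [hRest, Finset.mem_filter, Finset.mem_filter, mem_Rq] at hB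
    have hcard : q + 1 ≤ B.card := by
      have h4 := M.eRk_le_encard (B : Set α)
      rw [hB.1.1.2, Set.encard_coe_eq_coe_finsetCard] at h4
      have h4' : q ≤ B.card := by exact_mod_cast h4
      omega
    have hw := wInf_ge_of_succ_le_card hs (by omega) (hB.1.1.1.trans hG) hB.1.1.2 hcard
    have hq0 : (0 : ℚ) ≤ q := by positivity
    have : (q : ℚ) * (1 / ((q : ℚ) - 1)) ≤ (q : ℚ) * wInf M B := mul_le_mul_of_nonneg_left hw hq0
    have e : Φ ≤ (q : ℚ) * (1 / ((q : ℚ) - 1)) := by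
      rw [hΦ, div_le_iff₀ hq2, mul_one_div, div_mul_eq_mul_div, le_div_iff₀ hq1]
      nlinarith
    linarith
  -- the double count: `Σ_C (q + 1 − m(C)) ≥ I · (g − q)`
  have hgq : q ≤ G.card := by
    have h4 := M.eRk_le_encard (G : Set α)
    rw [hr, Set.encard_coe_eq_coe_finsetCard] at h4
    exact_mod_cast h4
  have hdc : (I.card : ℚ) * ((G.card : ℚ) - q) ≤ ∑ C ∈ N1, ((q : ℚ) + 1 - mTr M C) := by
    have h1 : ∑ B ∈ I, ((G \ B).card : ℚ) ≤ ∑ B ∈ I, ((N1.filter (fun C => B ⊆ C)).card : ℚ) := by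
      apply Finset.sum_le_sum
      intro B hB
      exact_mod_cast card_sdiff_le_card_supersets hr hB
    have h2 : ∑ B ∈ I, ((N1.filter (fun C => B ⊆ C)).card : ℚ) =
        ∑ C ∈ N1, ((I.filter (fun B => B ⊆ C)).card : ℚ) := by
      simp only [Finset.card_filter]
      push_cast
      exact Finset.sum_comm
    have h3 : ∑ C ∈ N1, ((I.filter (fun B => B ⊆ C)).card : ℚ) ≤ ∑ C ∈ N1, ((q : ℚ) + 1 - mTr M C) := by
      apply Finset.sum_le_sum
      intro C hC
      have h := card_subsets_add_mTr_le hG hC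
      have h' : (((I.filter (fun B => B ⊆ C)).card : ℕ) : ℚ) + (mTr M C : ℚ) ≤ (q : ℚ) + 1 := by
        exact_mod_cast h
      linarith
    have h0 : ∑ B ∈ I, ((G \ B).card : ℚ) = (I.card : ℚ) * ((G.card : ℚ) - q) := by
      rw [Finset.card_eq_sum_ones I, Nat.cast_sum, Finset.sum_mul]
      apply Finset.sum_congr rfl
      intro B hB
      rw [hI, Iq, Finset.mem_filter, mem_Rq] at hB
      rw [Finset.card_sdiff_of_subset hB.1.1, Nat.cast_sub (Finset.card_le_card hB.1.1), hB.2]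
      push_cast
      ring
    linarith
  -- assemble
  have hDF : (0 : ℚ) ≤ (DFq M G q 2 : ℚ) := by positivity
  have hΦ0 : 0 ≤ Φ := by rw [hΦ]; positivity
  have hJ : ∑ B ∈ Rq M G q, ((q : ℚ) * wInf M B - Φ) ≤ Jq M G q 2 := by
    unfold Jq Nq
    rw [Finset.sum_sub_distrib, Finset.sum_const, nsmul_eq_mul]
    have : (0 : ℚ) ≤ Φ * (DFq M G q 2 : ℚ) := mul_nonneg hΦ0 hDF
    have e : ∑ B ∈ Rq M G q, ((q : ℚ) + 2 - ((2 : ℕ) : ℚ)) * wInf M B = ∑ B ∈ Rq M G q, (q : ℚ) * wInf M B := by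
      apply Finset.sum_congr rfl
      intro B _
      push_cast
      ring
    rw [e, hΦ]
    linarith
  have hg' : (4 : ℚ) * q ≤ (G.card : ℚ) + 3 := by exact_mod_cast hg
  have hκsum : κ * ((I.card : ℚ) * ((G.card : ℚ) - q)) ≤ ∑ C ∈ N1, κ * ((q : ℚ) + 1 - mTr M C) := by
    rw [← Finset.mul_sum]
    exact mul_le_mul_of_nonneg_left hdc hκ0
  have hfinal : 0 ≤ (I.card : ℚ) * (-(2 / ((q : ℚ) + 1))) + κ * ((I.card : ℚ) * ((G.card : ℚ) - q)) := by
    have hx0 : (0 : ℚ) ≤ I.card := by positivity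
    have e : (I.card : ℚ) * (-(2 / ((q : ℚ) + 1))) + κ * ((I.card : ℚ) * ((G.card : ℚ) - q)) =
        (I.card : ℚ) * (2 * ((G.card : ℚ) - q - 3 * ((q : ℚ) - 1))) / (3 * ((q : ℚ) - 1) * ((q : ℚ) + 1)) := by
      rw [hκ]
      field_simp
      ring
    rw [e]
    apply div_nonneg
    · apply mul_nonneg hx0
      linarith
    · positivity
  linarith [hsplit, hIsum, hN1sum, hRestsum, hκsum, hfinal, hJ]

end PercRepro.GenQ
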